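import Literature.NumberTheory.LFunctions.Polymath15EffectiveApproximationProofs
import Literature.NumberTheory.LFunctions.DeBruijnNewmanProofs
import Literature.Analysis.Complex.WindingCertificate
import HarnessLib

/-!
# Polymath 15, §8.4: the barrier box from a winding certificate for `f_t`

Trunk T-ANT (`Literature/NumberTheory/LFunctions`); third companion of
`DeBruijnNewmanUpperBound.lean`, after `Polymath15EffectiveApproximation.lean` (the objects of
Polymath 15, Thm. 1.3 as the named fact `Polymath15.effective_approximation`, and the certified
computation `Polymath15.table1_row2_barrier_box` = the barrier half of §10, Table 1, row 2) and
`Polymath15EffectiveApproximationProofs.lean` (the bounds (1.10)–(1.12) of Thm. 1.3, proved).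

This file is the ANALYTIC HALF of a certificate for `table1_row2_barrier_box`: it reduces the
statement about `H_t` to a finite statement about the finite sums `f_t` of Thm. 1.3 — exactly
the statement that the barrier computation of Polymath 15, §8.4 establishes ("as `x + iy`
traverses the boundary `∂R` of the rectangle … the function `f_t(x+iy)` stays outside of the ball
… and furthermore has a winding number of zero around the origin", for every `0 ≤ t ≤ t₀`) — in
the discrete, kernel-checkable format of `Literature/Analysis/Complex/WindingCertificate.lean`
(piece lists with half-plane labels and a signed quarter-turn count), conditionally on Thm. 1.3.
Everything here is PROVED; no named facts are introduced. The numerical half (an interval-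
arithmetic evaluation of `f_t` on `∂R × [0, t₀]` by the stored sums of §7, checked by
`native_decide`) is not in the tree; its target is the hypothesis `hcert` of
`table1_row2_barrier_box_of_windingCert` and nothing else.

## Contents

* `HPiecesGt`, `VPiecesGt` — piece lists WITH A MARGIN `μ` (`Re((-i)^d f) > μ` on each closed
  piece) and `HPiecesGt.hpieces` : a margin-`μ` list for `f` is a valid list
  (`Literature.Analysis.Complex.HPieces`) for every `F` with `‖F − f‖ ≤ μ` along the edge;
  `WindingCertGt f μ a b c d` — four such lists around `[a,b] × [c,d]` with
  `Literature.Analysis.Complex.certTurns = 0`.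
* `HoverB t z = H_t(z)/M_t((1 − iz)/2)` (`= H_t/B_t` at `z = x + iy`, `HoverB_apply`), holomorphic
  on `U = {Re z > 0, Im z > −1}` (`analyticOnNhd_HoverB`, from `differentiable_deBruijnH_holds`,
  `differentiableAt_Mt` and `Mt_ne_zero`), continuous in `t` (`continuous_HoverB`, from
  `continuous_deBruijnH_uncurry`).
* `approx_at_zero` — Thm. 1.3 is stated for `t > 0`; the bound `‖H_t/B_t − f_t‖ ≤ μ` passes to
  `t = 0` by continuity in `t` when `N` does not jump (`ftN`, `continuous_ftN`).
* `box_zero_free_of_windingCert` — **the glue, general parameters** (`0 < t₀ ≤ 1/2`,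
  `0 ≤ y₀ < 1`, `X ≥ 200`): Thm. 1.3 + (`N` constant on the box) + (`errAB + errC0 ≤ μ` on the box)
  + (a `WindingCertGt` with margin `μ` for `z ↦ f_t(z)` on `[X, X+1] × [y₀, 1]` for every
  `t ∈ [0, t₀]`) ⟹ `H_t(x + iy) ≠ 0` on the closed box; proof = §8.4 with Rouché replaced by
  `Literature.Analysis.Complex.no_zero_of_winding_certificate`.
* **Row 2 of Table 1** (`X = 5·10¹² + 194858`, `t₀ = 0.186`, `y₀ = 0.16733`): `rsN_row2`
  (`N = 630783` on the box, the printed `N₀`), `errC0_row2` (`≤ 1.26·10⁻³`), `errAB_row2`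
  (`≤ 2·10⁻⁵`, using the proved `gamma_bound_holds`, `kappa_bound_holds`, `re_sStar_bound_holds`),
  `err_row2` (`errAB + errC0 ≤ 1/500`, the row-2 analogue of Prop. 8.1), and
  `table1_row2_barrier_box_of_windingCert` :
  `effective_approximation → (∀ t ∈ [0, 0.186], WindingCertGt (fz t) (1/500) X (X+1) y₀ 1) →
  table1_row2_barrier_box` (also `table1_row2_of_windingCert`).

## What is NOT here

The discharge `table1_row2_barrier_box_holds`: besides `effective_approximation_holds` (Thm. 1.3,
§4–§6 of the source; DISCHARGED since 2026-08-27 in `Polymath15EffectiveApproximationHolds.lean`,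
which also carries the Thm-1.3-free forms `box_zero_free_of_windingCert'`,
`table1_row2_barrier_box_of_windingCert'`, `table1_row2_of_windingCert'` of the theorems below) it
needs the numerical certificate (the hypothesis `hcert`), which is not in the tree. The
derivative bounds of Lemma 8.4 are not needed in this format (boxes in `(t, z)` replace mesh
points plus `D_z, D_t`); note that eq. (cond) of §8.4 as printed carries a spurious factor
`1/(2n)` on the `D_t |t′ − t|` term.

## References

* D. H. J. Polymath, *Effective approximation of heat flow evolution of the Riemann `ξ` function,
  and a new upper bound for the de Bruijn–Newman constant*, Res. Math. Sci. 6 (2019), Paper 31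
  (arXiv:1904.12438): Thm. 1.3, §8.2 (regions (a)–(c), Prop. 8.1), §8.4 (claim (a): Rouché on
  `∂R`, eq. (cond)), §10 Table 1 (row 2).
* P. Henrici, *Applied and Computational Complex Analysis*, Vol. 1 (1974), §4.6 (argument
  principle along polygons) — via `WindingCertificate.lean`.
-/

noncomputable section

open Complex Set Filter

open scoped Real Topology

namespace Literature.NumberTheory.LFunctions

namespace Polymath15

open Literature.Analysis.Complex

/-! ## Piece lists with a margin -/

/-- Horizontal piece list WITH MARGIN `μ` along the line `Im z = y`, started at `x₀`: on each closed
piece `[x_k, x_{k+1}]` with label `d`, `Re((-i)^d f(x + iy)) > μ` (compare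
`Literature.Analysis.Complex.HPieces`, the case `μ = 0`). [folklore] -/
def HPiecesGt (f : ℂ → ℂ) (μ y : ℝ) : ℝ → List (ℝ × Fin 4) → Prop
  | _, [] => True
  | x₀, (x₁, d₁) :: L =>
      x₀ ≤ x₁ ∧ (∀ x ∈ Icc x₀ x₁, μ < (qrot d₁ * f (x + y * I)).re) ∧ HPiecesGt f μ y x₁ L

/-- Vertical piece list WITH MARGIN `μ` along the line `Re z = x`, started at `y₀`.
[folklore] -/
def VPiecesGt (f : ℂ → ℂ) (μ x : ℝ) : ℝ → List (ℝ × Fin 4) → Prop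
  | _, [] => True
  | y₀, (y₁, d₁) :: L =>
      y₀ ≤ y₁ ∧ (∀ y ∈ Icc y₀ y₁, μ < (qrot d₁ * f (x + y * I)).re) ∧ VPiecesGt f μ x y₁ L

/-- If `Re((-i)^d w) > μ` and `‖w' − w‖ ≤ μ` then `Re((-i)^d w') > 0` (as `‖(-i)^d‖ = 1`,
cf. `Literature.NumberTheory.LFunctions.ZetaCert.norm_qrot`). [folklore] -/
lemma re_qrot_mul_pos_of_margin {d : Fin 4} {w w' : ℂ} {μ : ℝ} (h : μ < (qrot d * w).re)
    (hw : ‖w' - w‖ ≤ μ) : 0 < (qrot d * w').re := by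
  have hq : ‖qrot d‖ = 1 := by fin_cases d <;> simp [qrot]
  have h1 : (qrot d * w').re = (qrot d * w).re + (qrot d * (w' - w)).re := by
    rw [← Complex.add_re, ← mul_add, add_sub_cancel]
  have h2 : |(qrot d * (w' - w)).re| ≤ μ := by
    refine (Complex.abs_re_le_norm _).trans ?_
    rw [norm_mul, hq, one_mul]
    exact hw
  rw [h1]
  linarith [neg_abs_le (qrot d * (w' - w)).re]

/-- The endpoints of a horizontal piece list with margin increase. [folklore] -/
lemma HPiecesGt.le_piecesLast {f : ℂ → ℂ} {μ y : ℝ} :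
    ∀ {x₀ : ℝ} {L : List (ℝ × Fin 4)}, HPiecesGt f μ y x₀ L → x₀ ≤ piecesLast x₀ L
  | _, [], _ => le_rfl
  | _, (_, _) :: _, h => h.1.trans (HPiecesGt.le_piecesLast h.2.2)

/-- The endpoints of a vertical piece list with margin increase. [folklore] -/
lemma VPiecesGt.le_piecesLast {f : ℂ → ℂ} {μ x : ℝ} :
    ∀ {y₀ : ℝ} {L : List (ℝ × Fin 4)}, VPiecesGt f μ x y₀ L → y₀ ≤ piecesLast y₀ L
  | _, [], _ => le_rfl
  | _, (_, _) :: _, h => h.1.trans (VPiecesGt.le_piecesLast h.2.2)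

/-- A horizontal piece list with margin `μ` for `f` is a valid piece list (margin `0`) for every
`F` with `‖F − f‖ ≤ μ` along the segment. [folklore] -/
theorem HPiecesGt.hpieces {f F : ℂ → ℂ} {μ y : ℝ} :
    ∀ {x₀ : ℝ} {L : List (ℝ × Fin 4)}, HPiecesGt f μ y x₀ L →
      (∀ x ∈ Icc x₀ (piecesLast x₀ L), ‖F (x + y * I) - f (x + y * I)‖ ≤ μ) → HPieces F y x₀ L
  | _, [], _, _ => trivial
  | x₀, (x₁, d₁) :: L, h, hF => by
    have hlast : x₁ ≤ piecesLast x₁ L := HPiecesGt.le_piecesLast h.2.2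
    refine ⟨h.1, fun x hx ↦ ?_, HPiecesGt.hpieces h.2.2 fun x hx ↦ hF x ⟨h.1.trans hx.1, ?_⟩⟩
    · exact re_qrot_mul_pos_of_margin (h.2.1 x hx)
        (hF x ⟨hx.1, by simpa using hx.2.trans hlast⟩)
    · simpa using hx.2

/-- Vertical version of `HPiecesGt.hpieces`. [folklore] -/
theorem VPiecesGt.vpieces {f F : ℂ → ℂ} {μ x : ℝ} :
    ∀ {y₀ : ℝ} {L : List (ℝ × Fin 4)}, VPiecesGt f μ x y₀ L →
      (∀ y ∈ Icc y₀ (piecesLast y₀ L), ‖F (x + y * I) - f (x + y * I)‖ ≤ μ) → VPieces F x y₀ L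
  | _, [], _, _ => trivial
  | y₀, (y₁, d₁) :: L, h, hF => by
    have hlast : y₁ ≤ piecesLast y₁ L := VPiecesGt.le_piecesLast h.2.2
    refine ⟨h.1, fun y hy ↦ ?_, VPiecesGt.vpieces h.2.2 fun y hy ↦ hF y ⟨h.1.trans hy.1, ?_⟩⟩
    · exact re_qrot_mul_pos_of_margin (h.2.1 y hy)
        (hF y ⟨hy.1, by simpa using hy.2.trans hlast⟩)
    · simpa using hy.2

/-! ## `H_t / B_t` as a holomorphic function of `z = x + iy` -/

/-- `F_t(z) := H_t(z) / M_t((1 − iz)/2)`; for `z = x + iy` this is `H_t(x+iy)/B_t(x+iy)`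
(`HoverB_apply`), and it is holomorphic in `z` (Polymath 15, §8.2: "We can of course replace
`H_t(x+iy)` by `H_t(x+iy)/B_t(x+iy)`"; §8.5: "The left-hand side remains holomorphic").
[cite: Polymath2019, §8.2] -/
def HoverB (t : ℝ) (z : ℂ) : ℂ := deBruijnH t z / Mt t ((1 - I * z) / 2)

/-- `s₊(x + iy) = (1 − i(x+iy))/2`. [cite: Polymath2019, Cor. 6.4] -/
lemma sPlus_eq_affine (x y : ℝ) : sPlus x y = (1 - I * (x + y * I)) / 2 := by
  simp only [sPlus]
  ring_nf
  rw [I_sq]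
  ring

/-- `F_t(x + iy) = H_t(x + iy)/B_t(x + iy)`. [cite: Polymath2019, §8.2] -/
lemma HoverB_apply (t x y : ℝ) : HoverB t (x + y * I) = deBruijnH t (x + y * I) / Bt t x y := by
  rw [HoverB, Bt, sPlus_eq_affine]

/-- The open set `U = {Re z > 0, Im z > −1}` on which `F_t` is used. [folklore] -/
def certDomain : Set ℂ := {z | 0 < z.re ∧ -1 < z.im}

/-- `U` is open. [folklore] -/
lemma isOpen_certDomain : IsOpen certDomain :=
  (isOpen_lt continuous_const Complex.continuous_re).inter
    (isOpen_lt continuous_const Complex.continuous_im)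

/-- For `z ∈ U`, `s = (1 − iz)/2` has `Re s > 0` and `Im s ≠ 0`. [folklore] -/
lemma re_affine_pos {z : ℂ} (hz : z ∈ certDomain) :
    0 < ((1 - I * z) / 2).re ∧ ((1 - I * z) / 2).im ≠ 0 := by
  obtain ⟨hre, him⟩ := hz
  constructor
  · simp; linarith
  · simp; linarith

/-- `α` is differentiable at every `s` with `Re s > 0`, `Im s ≠ 0`. [cite: Polymath2019, §1] -/
lemma differentiableAt_alpha {s : ℂ} (hs : 0 < s.re) (hs' : s.im ≠ 0) :
    DifferentiableAt ℂ alpha s := by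
  have h0 : s ≠ 0 := fun h ↦ by simp [h] at hs
  have h1 : s - 1 ≠ 0 := fun h ↦ by
    have : s = 1 := sub_eq_zero.1 h
    simp [this] at hs'
  have hslit : s / (2 * π) ∈ slitPlane := by
    left
    rw [show s / (2 * π) = s * ((2 * π)⁻¹ : ℝ) by push_cast; ring, Complex.mul_re]
    simp only [Complex.ofReal_re, Complex.ofReal_im, mul_zero, sub_zero]
    exact mul_pos hs (by positivity)
  unfold alpha
  have hd1 : DifferentiableAt ℂ (fun s : ℂ ↦ 1 / (2 * s)) s :=
    (differentiableAt_const _).div (differentiableAt_id.const_mul _) (mul_ne_zero two_ne_zero h0)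
  have hd2 : DifferentiableAt ℂ (fun s : ℂ ↦ 1 / (s - 1)) s :=
    (differentiableAt_const _).div (differentiableAt_id.sub_const 1) h1
  have hd3 : DifferentiableAt ℂ (fun s : ℂ ↦ 1 / 2 * Complex.log (s / (2 * π))) s :=
    ((differentiableAt_id.div_const _).clog hslit).const_mul _
  exact (hd1.add hd2).add hd3

/-- `M₀` is differentiable at every `s` with `Re s > 0`, `Im s ≠ 0`. [cite: Polymath2019, §1] -/
lemma differentiableAt_M₀ {s : ℂ} (hs : 0 < s.re) :
    DifferentiableAt ℂ M₀ s := by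
  have hslit : s / 2 ∈ slitPlane := by
    left
    simpa using hs
  have hπ : (π : ℂ) ≠ 0 := by exact_mod_cast Real.pi_ne_zero
  unfold M₀
  have hd1 : DifferentiableAt ℂ (fun s : ℂ ↦ 1 / 8 * (s * (s - 1) / 2)) s :=
    ((differentiableAt_id.mul (differentiableAt_id.sub_const 1)).div_const 2).const_mul _
  have hd2 : DifferentiableAt ℂ (fun s : ℂ ↦ (π : ℂ) ^ (-s / 2)) s :=
    (differentiableAt_id.neg.div_const 2).const_cpow (Or.inl hπ)
  have hd3 : DifferentiableAt ℂ
      (fun s : ℂ ↦ Complex.exp ((s / 2 - 1 / 2) * Complex.log (s / 2) - s / 2)) s :=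
    ((((differentiableAt_id.div_const 2).sub_const _).mul
      ((differentiableAt_id.div_const 2).clog hslit)).sub (differentiableAt_id.div_const 2)).cexp
  exact ((hd1.mul hd2).mul (differentiableAt_const _)).mul hd3

/-- `M_t` is differentiable at every `s` with `Re s > 0`, `Im s ≠ 0`. [cite: Polymath2019, §1] -/
lemma differentiableAt_Mt (t : ℝ) {s : ℂ} (hs : 0 < s.re) (hs' : s.im ≠ 0) :
    DifferentiableAt ℂ (Mt t) s := by
  unfold Mt
  exact (((differentiableAt_alpha hs hs').pow 2).const_mul _).cexp.mul (differentiableAt_M₀ hs)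

/-- `F_t = H_t/B_t` is holomorphic on `U = {Re z > 0, Im z > −1}` (there `s = (1 − iz)/2` has
`Re s > 0`, `s ≠ 0, 1`, so `M_t(s) ≠ 0` and `M_t` is holomorphic at `s`; `H_t` is entire).
[cite: Polymath2019, §8.2] -/
theorem differentiableOn_HoverB (t : ℝ) : DifferentiableOn ℂ (HoverB t) certDomain := by
  intro z hz
  obtain ⟨hre, him⟩ := re_affine_pos hz
  have h0 : (1 - I * z) / 2 ≠ 0 := fun h ↦ by simp [h] at hre
  have h1 : (1 - I * z) / 2 ≠ 1 := fun h ↦ by simp [h] at him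
  have haff : DifferentiableAt ℂ (fun z : ℂ ↦ (1 - I * z) / 2) z :=
    ((differentiableAt_id.const_mul I).const_sub 1).div_const 2
  have hM : DifferentiableAt ℂ (Mt t ∘ fun z : ℂ ↦ (1 - I * z) / 2) z :=
    DifferentiableAt.comp (g := Mt t) z (differentiableAt_Mt t hre him) haff
  have hF : DifferentiableAt ℂ (HoverB t) z :=
    ((differentiable_deBruijnH_holds t) z).div hM (Mt_ne_zero t h0 h1)
  exact hF.differentiableWithinAt

/-- `F_t` is analytic on a neighbourhood of every point of `U`. [cite: Polymath2019, §8.2] -/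
theorem analyticOnNhd_HoverB (t : ℝ) : AnalyticOnNhd ℂ (HoverB t) certDomain :=
  (differentiableOn_HoverB t).analyticOnNhd isOpen_certDomain

/-- `F_t(z) ≠ 0 ⟹ H_t(z) ≠ 0`. [folklore] -/
lemma deBruijnH_ne_zero_of_HoverB {t : ℝ} {z : ℂ} (h : HoverB t z ≠ 0) : deBruijnH t z ≠ 0 :=
  fun h0 ↦ h (by rw [HoverB, h0, zero_div])

/-! ## Continuity in `t` and the approximation at `t = 0` -/

/-- `t ↦ M_t(s)` is continuous. [cite: Polymath2019, §1] -/
lemma continuous_Mt (s : ℂ) : Continuous fun t : ℝ ↦ Mt t s := by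
  unfold Mt
  fun_prop

/-- `t ↦ F_t(z)` is continuous for `z ∈ U`. [cite: Polymath2019, §8.2] -/
lemma continuous_HoverB {z : ℂ} (hz : z ∈ certDomain) : Continuous fun t : ℝ ↦ HoverB t z := by
  obtain ⟨hre, him⟩ := re_affine_pos hz
  have h0 : (1 - I * z) / 2 ≠ 0 := fun h ↦ by simp [h] at hre
  have h1 : (1 - I * z) / 2 ≠ 1 := fun h ↦ by simp [h] at him
  have hH : Continuous fun t : ℝ ↦ deBruijnH t z :=
    continuous_deBruijnH_uncurry.comp (continuous_id.prodMk continuous_const)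
  exact hH.div (continuous_Mt _) fun t ↦ Mt_ne_zero t h0 h1

/-- The main term `f_t(x+iy)` with the Riemann–Siegel length frozen at `N`
(`ft t x y = ftN (rsN t x) t x y`). [cite: Polymath2019, Thm. 1.3] -/
def ftN (N : ℕ) (t x y : ℝ) : ℂ :=
  ∑ n ∈ Finset.Icc 1 N, (bCoeff t n : ℂ) / (n : ℂ) ^ sStar t x y +
    gamma t x y * ∑ n ∈ Finset.Icc 1 N,
      (((n : ℝ) ^ y : ℝ) : ℂ) * (bCoeff t n : ℂ) /
        (n : ℂ) ^ (starRingEnd ℂ (sStar t x y) + kappa t x y)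

/-- `ft` is `ftN` at the actual length `N = rsN t x` (definitional). [cite: Polymath2019, Thm. 1.3] -/
lemma ft_eq_ftN (t x y : ℝ) : ft t x y = ftN (rsN t x) t x y := rfl

/-- `t ↦ f_t(x + iy)` is continuous as long as `N` is frozen (`x ≠ 0`).
[cite: Polymath2019, Thm. 1.3] -/
lemma continuous_ftN (N : ℕ) {x : ℝ} (hx : x ≠ 0) (y : ℝ) :
    Continuous fun t : ℝ ↦ ftN N t x y := by
  have hsS : Continuous fun t : ℝ ↦ sStar t x y := by unfold sStar; fun_prop
  have hb : ∀ n : ℕ, Continuous fun t : ℝ ↦ (bCoeff t n : ℂ) := fun n ↦ by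
    unfold bCoeff; fun_prop
  have hk : Continuous fun t : ℝ ↦ kappa t x y := by unfold kappa; fun_prop
  have hne : ∀ n ∈ Finset.Icc 1 N, (n : ℂ) ≠ 0 := fun n hn ↦ by
    have : 1 ≤ n := (Finset.mem_Icc.1 hn).1
    exact_mod_cast (show n ≠ 0 by omega)
  have hg : Continuous fun t : ℝ ↦ gamma t x y := by
    unfold gamma
    refine (continuous_Mt _).div (continuous_Mt _) fun t ↦ Mt_ne_zero t ?_ ?_ <;> intro h <;>
      apply hx
    · simpa [sPlus] using congrArg Complex.im h
    · simpa [sPlus] using congrArg Complex.im h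
  unfold ftN
  refine (continuous_finsetSum _ fun n hn ↦ ?_).add
    (hg.mul (continuous_finsetSum _ fun n hn ↦ ?_))
  · exact (hb n).div (hsS.const_cpow (Or.inl (hne n hn))) fun t ↦
      cpow_ne_zero_iff.2 (Or.inl (hne n hn))
  · refine (continuous_const.mul (hb n)).div
      ((((Complex.continuous_conj.comp hsS)).add hk).const_cpow (Or.inl (hne n hn))) fun t ↦
      cpow_ne_zero_iff.2 (Or.inl (hne n hn))

/-- **The approximation at `t = 0` by continuity.** If `‖F_t(x+iy) − f_t(x+iy)‖ ≤ μ` for all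
`0 < t ≤ t₀` and `N` does not jump on `[0, t₀]`, then the same bound holds at `t = 0`
(both sides are continuous in `t`; Thm. 1.3 is stated for `t > 0` only).
[cite: Polymath2019, §8.4] -/
theorem approx_at_zero {t₀ x y μ : ℝ} (ht₀ : 0 < t₀) (hx : 0 < x) (hy : -1 < y)
    (hN : ∀ t ∈ Icc 0 t₀, rsN t x = rsN 0 x)
    (h : ∀ t ∈ Ioc 0 t₀, ‖HoverB t (x + y * I) - ft t x y‖ ≤ μ) :
    ‖HoverB 0 (x + y * I) - ft 0 x y‖ ≤ μ := by
  have hz : (x : ℂ) + y * I ∈ certDomain := by constructor <;> simp [hx, hy]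
  set g : ℝ → ℝ := fun t ↦ ‖HoverB t (x + y * I) - ftN (rsN 0 x) t x y‖ with hg
  have hgc : Continuous g :=
    ((continuous_HoverB hz).sub (continuous_ftN _ hx.ne' y)).norm
  have hclosed : IsClosed {t | g t ≤ μ} := isClosed_le hgc continuous_const
  have hsub : Ioc 0 t₀ ⊆ {t | g t ≤ μ} := fun t ht ↦ by
    have := h t ht
    simp only [Set.mem_setOf_eq, hg, ft_eq_ftN, hN t ⟨ht.1.le, ht.2⟩] at this ⊢
    exact this
  have h0 : (0 : ℝ) ∈ {t | g t ≤ μ} := by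
    apply hclosed.closure_subset_iff.2 hsub
    rw [closure_Ioc ht₀.ne]
    exact ⟨le_rfl, ht₀.le⟩
  simpa [hg, ft_eq_ftN] using h0

/-! ## The barrier box from a winding certificate with margin -/

/-- `f_t` as a function of the complex variable `z = x + iy` (it is NOT holomorphic in general —
`N` jumps with `x` — and need not be: only `F_t = H_t/B_t` is fed to the argument principle).
[cite: Polymath2019, Thm. 1.3] -/
def fz (t : ℝ) (z : ℂ) : ℂ := ft t z.re z.im

/-- `f_t(x + iy)` as a function of `z` agrees with `ft t x y`. [cite: Polymath2019, Thm. 1.3] -/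
@[simp] lemma fz_apply (t x y : ℝ) : fz t (x + y * I) = ft t x y := by
  simp [fz]

/-- **A winding certificate with margin `μ` for `f` on the rectangle `[a,b] × [c,d]`**: piece
lists with margin `μ` on the four edges (bottom and top from `x = a` to `x = b`, left and right
from `y = c` to `y = d`; the first piece of each edge displayed) whose signed quarter-turn count
around the boundary (`Literature.Analysis.Complex.certTurns`) vanishes. This is the output format
of the barrier computation of Polymath 15, §8.4 ("the function `f_t(x+iy)` stays outside of the
ball … and furthermore has a winding number of zero around the origin"), in the discrete form of
`Literature/Analysis/Complex/WindingCertificate.lean`. [cite: Polymath2019, §8.4] -/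
def WindingCertGt (f : ℂ → ℂ) (μ a b c d : ℝ) : Prop :=
  ∃ (xB : ℝ) (dB : Fin 4) (LB : List (ℝ × Fin 4)) (yR : ℝ) (dR : Fin 4) (LR : List (ℝ × Fin 4))
    (xT : ℝ) (dT : Fin 4) (LT : List (ℝ × Fin 4)) (yL : ℝ) (dL : Fin 4) (LL : List (ℝ × Fin 4)),
    (HPiecesGt f μ c a ((xB, dB) :: LB) ∧ piecesLast xB LB = b) ∧
    (VPiecesGt f μ b c ((yR, dR) :: LR) ∧ piecesLast yR LR = d) ∧
    (HPiecesGt f μ d a ((xT, dT) :: LT) ∧ piecesLast xT LT = b) ∧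
    (VPiecesGt f μ a c ((yL, dL) :: LL) ∧ piecesLast yL LL = d) ∧
    certTurns dB LB dR LR dT LT dL LL = 0

/-- **The barrier box from a winding certificate (Polymath 15, §8.2 (a) and §8.4, general
parameters).** Assume Thm. 1.3 (`effective_approximation`). Let `0 < t₀ ≤ 1/2`, `0 ≤ y₀ < 1`,
`X ≥ 200`, and suppose that on the box `0 ≤ t ≤ t₀`, `X ≤ x ≤ X + 1`, `y₀ ≤ y ≤ 1`:
(1) the Riemann–Siegel length `N = ⌊√(x/4π + t/16)⌋` does not depend on `t`;
(2) the error majorant of Thm. 1.3 satisfies `e_A + e_B + e_{C,0} ≤ errAB + errC0 ≤ μ` (`t > 0`);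
(3) for every `t ∈ [0, t₀]` there is a winding certificate with margin `μ` for `z ↦ f_t(z)` on the
rectangle `R = [X, X+1] × [y₀, 1]` (`WindingCertGt`).
Then `H_t(x + iy) ≠ 0` on the whole (closed) box. Proof as in §8.4 with Rouché replaced by the
discrete argument principle of `WindingCertificate.lean`: `F_t = H_t/B_t` is holomorphic near `R`
(`analyticOnNhd_HoverB`), `|F_t − f_t| ≤ μ` on `∂R` (Thm. 1.3 for `t > 0`; `approx_at_zero` for
`t = 0`), so each piece with `Re((-i)^d f_t) > μ` is a piece with `Re((-i)^d F_t) > 0`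
(`HPiecesGt.hpieces`), and zero quarter turns give `F_t ≠ 0` inside `R`
(`Literature.Analysis.Complex.no_zero_of_winding_certificate`) and on `∂R` (`HPieces.ne_zero`).
[cite: Polymath2019, §8.4] -/
theorem box_zero_free_of_windingCert (h : effective_approximation) {t₀ X y₀ μ : ℝ}
    (ht₀ : 0 < t₀) (ht₀' : t₀ ≤ 1 / 2) (hy₀ : 0 ≤ y₀) (hy₀' : y₀ < 1) (hX : 200 ≤ X)
    (hN : ∀ t ∈ Icc 0 t₀, ∀ x ∈ Icc X (X + 1), rsN t x = rsN 0 x)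
    (herr : ∀ t ∈ Ioc 0 t₀, ∀ x ∈ Icc X (X + 1), ∀ y ∈ Icc y₀ 1, errAB t x y + errC0 t x y ≤ μ)
    (hcert : ∀ t ∈ Icc 0 t₀, WindingCertGt (fz t) μ X (X + 1) y₀ 1) :
    ∀ t x y : ℝ, 0 ≤ t → t ≤ t₀ → X ≤ x → x ≤ X + 1 → y₀ ≤ y → y ≤ 1 →
      deBruijnH t (x + y * I) ≠ 0 := by
  intro t x y ht htt hx hxx hy hyy
  -- the approximation `‖F_t − f_t‖ ≤ μ` on the box, including `t = 0`
  have hpos : ∀ t' ∈ Ioc 0 t₀, ∀ x' ∈ Icc X (X + 1), ∀ y' ∈ Icc y₀ 1,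
      ‖HoverB t' (x' + y' * I) - ft t' x' y'‖ ≤ μ := by
    intro t' ht' x' hx' y' hy'
    rw [HoverB_apply]
    exact (h t' x' y' ⟨ht'.1, ht'.2.trans ht₀', hy₀.trans hy'.1, hy'.2, hX.trans hx'.1⟩).trans
      (herr t' ht' x' hx' y' hy')
  have happ : ∀ x' ∈ Icc X (X + 1), ∀ y' ∈ Icc y₀ 1,
      ‖HoverB t (x' + y' * I) - fz t (x' + y' * I)‖ ≤ μ := by
    intro x' hx' y' hy'
    rw [fz_apply]
    rcases ht.eq_or_lt with rfl | htpos
    · exact approx_at_zero ht₀ (by linarith [hx'.1]) (by linarith [hy'.1])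
        (fun s hs ↦ hN s hs x' hx') fun s hs ↦ hpos s hs x' hx' y' hy'
    · exact hpos t ⟨htpos, htt⟩ x' hx' y' hy'
  -- the certificate at time `t`, transported to `F_t`
  obtain ⟨xB, dB, LB, yR, dR, LR, xT, dT, LT, yL, dL, LL, ⟨hB, hBe⟩, ⟨hR, hRe⟩, ⟨hT, hTe⟩,
    ⟨hL, hLe⟩, hturns⟩ := hcert t ⟨ht, htt⟩
  have hXmem : X ∈ Icc X (X + 1) := ⟨le_rfl, by linarith⟩
  have hX1mem : X + 1 ∈ Icc X (X + 1) := ⟨by linarith, le_rfl⟩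
  have hy₀mem : y₀ ∈ Icc y₀ 1 := ⟨le_rfl, hy₀'.le⟩
  have h1mem : (1 : ℝ) ∈ Icc y₀ 1 := ⟨hy₀'.le, le_rfl⟩
  have hB' : HPieces (HoverB t) y₀ X ((xB, dB) :: LB) :=
    hB.hpieces fun x' hx' ↦ happ x' (by simpa [hBe] using hx') y₀ hy₀mem
  have hT' : HPieces (HoverB t) 1 X ((xT, dT) :: LT) :=
    hT.hpieces fun x' hx' ↦ happ x' (by simpa [hTe] using hx') 1 h1mem
  have hR' : VPieces (HoverB t) (X + 1) y₀ ((yR, dR) :: LR) :=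
    hR.vpieces fun y' hy' ↦ happ (X + 1) hX1mem y' (by simpa [hRe] using hy')
  have hL' : VPieces (HoverB t) X y₀ ((yL, dL) :: LL) :=
    hL.vpieces fun y' hy' ↦ happ X hXmem y' (by simpa [hLe] using hy')
  have hana : AnalyticOnNhd ℂ (HoverB t) (Icc X (X + 1) ×ℂ Icc y₀ 1) :=
    (analyticOnNhd_HoverB t).mono fun z hz ↦ ⟨by linarith [hz.1.1], by linarith [hz.2.1]⟩
  have hint := no_zero_of_winding_certificate (f := HoverB t) (by linarith) hy₀' hana hB' hBe hR'
    hRe hT' hTe hL' hLe hturns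
  refine deBruijnH_ne_zero_of_HoverB ?_
  -- interior or one of the four edges
  rcases hx.eq_or_lt with rfl | hx₁
  · exact hL'.ne_zero y (by simpa [hLe] using And.intro hy hyy) (by simp)
  rcases hxx.eq_or_lt with rfl | hx₂
  · exact hR'.ne_zero y (by simpa [hRe] using And.intro hy hyy) (by simp)
  rcases hy.eq_or_lt with rfl | hy₁
  · exact hB'.ne_zero x (by simpa [hBe] using And.intro hx hxx) (by simp)
  rcases hyy.eq_or_lt with rfl | hy₂
  · exact hT'.ne_zero x (by simpa [hTe] using And.intro hx hxx) (by simp)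
  exact hint (x + y * I) ⟨by simpa using And.intro hx₁ hx₂, by simpa using And.intro hy₁ hy₂⟩

/-! ## `N = 630783` on the row-2 box -/

/-- On the box `0 ≤ t ≤ 0.186`, `5·10¹² + 194858 ≤ x ≤ 5·10¹² + 194859` the Riemann–Siegel length
is constant: `N = ⌊√(x/4π + t/16)⌋ = 630783` (Table 1, row 2, column `N₀`; here
`x/4π − 630783² ≥ 1.3·10⁵` and `630784² − x/4π − t/16 ≥ 10⁶`).
[cite: Polymath2019, §10, Table 1 (row 2)] -/
theorem rsN_row2 {t x : ℝ} (ht : 0 ≤ t) (ht' : t ≤ 0.186) (hx : (5 * 10 ^ 12 + 194858 : ℝ) ≤ x)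
    (hx' : x ≤ 5 * 10 ^ 12 + 194858 + 1) : rsN t x = 630783 := by
  have hπ₁ := Real.pi_gt_d6
  have hπ₂ := Real.pi_lt_d6
  have h4π : 0 < 4 * π := by positivity
  unfold rsN
  rw [Nat.floor_eq_iff (Real.sqrt_nonneg _)]
  constructor
  · rw [Real.le_sqrt (by norm_num) (by positivity)]
    have h1 : (630783 : ℝ) ^ 2 ≤ x / (4 * π) := by
      rw [le_div_iff₀ h4π]
      nlinarith
    push_cast
    linarith
  · rw [Real.sqrt_lt' (by norm_num)]
    have h1 : x / (4 * π) < 630784 ^ 2 - 0.012 := by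
      rw [div_lt_iff₀ h4π]
      nlinarith
    push_cast
    linarith

/-! ## The error majorant on the row-2 box: `errAB + errC0 ≤ 1/500` -/

section errBounds

variable {t x y : ℝ}

/-- `u = x/4π` satisfies `630783² ≤ u ≤ 2^39` on the box. [folklore] -/
lemma row2_u_bounds (hx : (5 * 10 ^ 12 + 194858 : ℝ) ≤ x)
    (hx' : x ≤ 5 * 10 ^ 12 + 194858 + 1) :
    (630783 : ℝ) ^ 2 ≤ x / (4 * π) ∧ x / (4 * π) ≤ 2 ^ 39 := by
  have hπ₁ := Real.pi_gt_d6
  have hπ₂ := Real.pi_lt_d6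
  have h4π : 0 < 4 * π := by positivity
  constructor
  · rw [le_div_iff₀ h4π]; nlinarith
  · rw [div_le_iff₀ h4π]; nlinarith

/-- `0 ≤ log(x/4π) ≤ 28` on the box. [folklore] -/
lemma row2_log_u_bounds (hx : (5 * 10 ^ 12 + 194858 : ℝ) ≤ x)
    (hx' : x ≤ 5 * 10 ^ 12 + 194858 + 1) :
    0 ≤ Real.log (x / (4 * π)) ∧ Real.log (x / (4 * π)) ≤ 28 := by
  obtain ⟨hu₁, hu₂⟩ := row2_u_bounds hx hx'
  have hu1 : (1 : ℝ) ≤ x / (4 * π) := le_trans (by norm_num) hu₁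
  refine ⟨Real.log_nonneg hu1, ?_⟩
  calc Real.log (x / (4 * π)) ≤ Real.log (2 ^ 39) := Real.log_le_log (by linarith) hu₂
    _ = 39 * Real.log 2 := by rw [Real.log_pow]; norm_num
    _ ≤ 28 := by linarith [Real.log_two_lt_d9]

/-- `log n ≤ (1/2) log(x/4π)` for `1 ≤ n ≤ 630783` on the box (since `n² ≤ x/4π`). [folklore] -/
lemma row2_log_n_le {n : ℕ} (hn : 1 ≤ n) (hn' : n ≤ 630783)
    (hx : (5 * 10 ^ 12 + 194858 : ℝ) ≤ x) (hx' : x ≤ 5 * 10 ^ 12 + 194858 + 1) :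
    0 ≤ Real.log n ∧ 2 * Real.log n ≤ Real.log (x / (4 * π)) := by
  obtain ⟨hu₁, _⟩ := row2_u_bounds hx hx'
  have hn1 : (1 : ℝ) ≤ n := by exact_mod_cast hn
  have hnN : (n : ℝ) ≤ 630783 := by exact_mod_cast hn'
  refine ⟨Real.log_nonneg hn1, ?_⟩
  have h2 : Real.log ((n : ℝ) ^ 2) = 2 * Real.log n := by
    rw [Real.log_pow]; norm_num
  rw [← h2]
  exact Real.log_le_log (by positivity) (le_trans (by nlinarith) hu₁)

/-- The bound `errC0 ≤ 1.26·10⁻³` on the row-2 box (`(x/4π)^{-(1+y)/4} ≤ (x/4π)^{-1/4} ≤ 1/794`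
and the exponential factor is `≤ e^{10⁻⁵}`). [cite: Polymath2019, Prop. 8.1 (proof)] -/
theorem errC0_row2 (ht : 0 ≤ t) (ht' : t ≤ 0.186) (hx : (5 * 10 ^ 12 + 194858 : ℝ) ≤ x)
    (hx' : x ≤ 5 * 10 ^ 12 + 194858 + 1) (hy : 0 ≤ y) (hy' : y ≤ 1) :
    errC0 t x y ≤ 0.00126 := by
  obtain ⟨hu₁, hu₂⟩ := row2_u_bounds hx hx'
  obtain ⟨hl₁, hl₂⟩ := row2_log_u_bounds hx hx'
  have hN : rsN t x = 630783 := rsN_row2 ht ht' hx hx'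
  set u := x / (4 * π) with hu
  have hu0 : 0 < u := lt_of_lt_of_le (by norm_num) hu₁
  have hu1 : 1 ≤ u := le_trans (by norm_num) hu₁
  -- the power
  have hpow : u ^ (-(1 + y) / 4) ≤ 1 / 794 := by
    have h1 : u ^ (-(1 + y) / 4) ≤ u ^ (-(1 / 4 : ℝ)) :=
      Real.rpow_le_rpow_of_exponent_le hu1 (by linarith)
    have h794 : (794 : ℝ) ^ 4 ≤ u := le_trans (by norm_num) hu₁
    have h2 : (794 : ℝ) ≤ u ^ (1 / 4 : ℝ) := by
      have := Real.rpow_le_rpow (by norm_num) h794 (by norm_num : (0 : ℝ) ≤ 1 / 4)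
      rw [show (1 / 4 : ℝ) = ((4 : ℕ) : ℝ)⁻¹ by norm_num,
        Real.pow_rpow_inv_natCast (by norm_num) (by norm_num)] at this
      rw [show (1 / 4 : ℝ) = ((4 : ℕ) : ℝ)⁻¹ by norm_num]
      exact this
    have h3 : u ^ (-(1 / 4 : ℝ)) = (u ^ (1 / 4 : ℝ))⁻¹ := Real.rpow_neg hu0.le _
    rw [h3] at h1
    refine h1.trans ?_
    rw [show (1 : ℝ) / 794 = 794⁻¹ by norm_num]
    exact inv_anti₀ (by norm_num : (0 : ℝ) < 794) h2
  -- the exponential factor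
  have h3y : (3 : ℝ) ^ y ≤ 3 := by
    simpa using Real.rpow_le_rpow_of_exponent_le (by norm_num : (1 : ℝ) ≤ 3) hy'
  have h3y' : (3 : ℝ) ^ (-y) ≤ 1 :=
    Real.rpow_le_one_of_one_le_of_nonpos (by norm_num) (by linarith)
  have hnorm : ‖(Real.log u : ℂ) + π / 2 * I‖ ≤ 30 := by
    refine (norm_add_le _ _).trans ?_
    have h1 : ‖(Real.log u : ℂ)‖ ≤ 28 := by
      rw [Complex.norm_real, Real.norm_eq_abs, abs_of_nonneg hl₁]; exact hl₂
    have h2 : ‖(π / 2 * I : ℂ)‖ ≤ 2 := by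
      rw [norm_mul, Complex.norm_I, mul_one,
        show (π / 2 : ℂ) = ((π / 2 : ℝ) : ℂ) by push_cast; ring, Complex.norm_real,
        Real.norm_eq_abs, abs_of_nonneg (by positivity)]
      linarith [Real.pi_lt_four]
    linarith
  have hexp : Real.exp (-(t / 16) * Real.log u ^ 2 +
      1.24 * ((3 : ℝ) ^ y + (3 : ℝ) ^ (-y)) / ((rsN t x : ℝ) - 0.125) +
        (3 * ‖(Real.log u : ℂ) + π / 2 * I‖ + 10.44) / (x - 12)) ≤ 1.0001 := by
    rw [hN]
    have hA : -(t / 16) * Real.log u ^ 2 ≤ 0 := by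
      have : 0 ≤ t / 16 * Real.log u ^ 2 := by positivity
      linarith
    have hB : 1.24 * ((3 : ℝ) ^ y + (3 : ℝ) ^ (-y)) / ((630783 : ℕ) - 0.125 : ℝ) ≤ 0.00001 := by
      rw [div_le_iff₀ (by norm_num)]
      push_cast
      nlinarith
    have hC : (3 * ‖(Real.log u : ℂ) + π / 2 * I‖ + 10.44) / (x - 12) ≤ 0.00001 := by
      rw [div_le_iff₀ (by linarith)]
      nlinarith
    have hsum : -(t / 16) * Real.log u ^ 2 +
        1.24 * ((3 : ℝ) ^ y + (3 : ℝ) ^ (-y)) / ((630783 : ℕ) - 0.125 : ℝ) +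
          (3 * ‖(Real.log u : ℂ) + π / 2 * I‖ + 10.44) / (x - 12) ≤ 0.00002 := by linarith
    calc Real.exp _ ≤ Real.exp 0.00002 := Real.exp_le_exp.2 hsum
      _ ≤ 1.0001 := by
        have := Real.abs_exp_sub_one_le (x := 0.00002) (by norm_num)
        rw [abs_le] at this
        norm_num at this
        linarith [this.2]
  have hexp0 : 0 ≤ Real.exp (-(t / 16) * Real.log u ^ 2 +
      1.24 * ((3 : ℝ) ^ y + (3 : ℝ) ^ (-y)) / ((rsN t x : ℝ) - 0.125) +
        (3 * ‖(Real.log u : ℂ) + π / 2 * I‖ + 10.44) / (x - 12)) := (Real.exp_pos _).le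
  unfold errC0
  calc u ^ (-(1 + y) / 4) * _ ≤ 1 / 794 * 1.0001 :=
        mul_le_mul hpow hexp hexp0 (by norm_num)
    _ ≤ 0.00126 := by norm_num

/-- `630783 ^ ‖κ‖ ≤ 2` on the box (`‖κ‖ ≤ ty/(2(x−6)) ≤ 1/20`, `630783 ≤ 2^20`).
[cite: Polymath2019, Thm. 1.3] -/
lemma row2_N_rpow_kappa_le (ht : 0 < t) (ht' : t ≤ 0.186)
    (hx : (5 * 10 ^ 12 + 194858 : ℝ) ≤ x) (hy : 0 ≤ y) (hy' : y ≤ 1) :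
    (630783 : ℝ) ^ ‖kappa t x y‖ ≤ 2 := by
  have hk := kappa_bound_holds t x y ⟨ht, by linarith, hy, hy', by linarith⟩
  have hk' : ‖kappa t x y‖ ≤ 1 / 20 := by
    refine hk.trans ?_
    rw [div_le_div_iff₀ (by linarith) (by norm_num)]
    nlinarith
  calc (630783 : ℝ) ^ ‖kappa t x y‖ ≤ (630783 : ℝ) ^ (1 / 20 : ℝ) :=
        Real.rpow_le_rpow_of_exponent_le (by norm_num) hk'
    _ ≤ ((2 : ℝ) ^ 20) ^ (1 / 20 : ℝ) := Real.rpow_le_rpow (by norm_num) (by norm_num) (by norm_num)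
    _ = 2 := by
      rw [show (1 / 20 : ℝ) = ((20 : ℕ) : ℝ)⁻¹ by norm_num,
        Real.pow_rpow_inv_natCast (by norm_num) (by norm_num)]

/-- `n^y · (x/4π)^{−y/2} ≤ 1` for `1 ≤ n ≤ 630783` on the box (`n ≤ √(x/4π)`). [folklore] -/
lemma row2_n_rpow_mul_le {n : ℕ} (hn' : n ≤ 630783) (hx : (5 * 10 ^ 12 + 194858 : ℝ) ≤ x)
    (hx' : x ≤ 5 * 10 ^ 12 + 194858 + 1) (hy : 0 ≤ y) :
    (n : ℝ) ^ y * (x / (4 * π)) ^ (-y / 2) ≤ 1 := by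
  obtain ⟨hu₁, _⟩ := row2_u_bounds hx hx'
  set u := x / (4 * π) with hu
  have hu0 : 0 < u := lt_of_lt_of_le (by norm_num) hu₁
  have hnN : (n : ℝ) ≤ 630783 := by exact_mod_cast hn'
  have hn0 : (0 : ℝ) ≤ n := by positivity
  have hsq : (n : ℝ) ≤ Real.sqrt u := by
    rw [Real.le_sqrt hn0 hu0.le]
    exact le_trans (by nlinarith) hu₁
  have h1 : u ^ (-y / 2) = (u ^ (-(1 / 2) : ℝ)) ^ y := by
    rw [← Real.rpow_mul hu0.le]; congr 1; ring
  have h2 : u ^ (-(1 / 2) : ℝ) = (Real.sqrt u)⁻¹ := by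
    rw [Real.rpow_neg hu0.le, Real.sqrt_eq_rpow]
  rw [h1, ← Real.mul_rpow hn0 (Real.rpow_nonneg hu0.le _), h2]
  refine Real.rpow_le_one (by positivity) ?_ hy
  rw [mul_inv_le_iff₀ (Real.sqrt_pos.2 hu0), one_mul]
  exact hsq

/-- `1 + ‖γ‖ N^{‖κ‖} n^y ≤ 4` on the box for `1 ≤ n ≤ N = 630783` (Thm. 1.3: `|γ| ≤ e^{0.02y}
(x/4π)^{−y/2}`, `|κ| ≤ ty/(2(x−6))`). [cite: Polymath2019, Prop. 8.1 (proof)] -/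
lemma row2_weight_le (ht : 0 < t) (ht' : t ≤ 0.186) (hx : (5 * 10 ^ 12 + 194858 : ℝ) ≤ x)
    (hx' : x ≤ 5 * 10 ^ 12 + 194858 + 1) (hy : 0 ≤ y) (hy' : y ≤ 1) {n : ℕ} (hn' : n ≤ 630783) :
    1 + ‖gamma t x y‖ * (630783 : ℝ) ^ ‖kappa t x y‖ * (n : ℝ) ^ y ≤ 4 := by
  have hg := gamma_bound_holds t x y ⟨ht, by linarith, hy, hy', by linarith⟩
  have he : Real.exp (0.02 * y) ≤ 1.04 := by
    calc Real.exp (0.02 * y) ≤ Real.exp 0.02 := Real.exp_le_exp.2 (by nlinarith)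
      _ ≤ 1.04 := by
        have := Real.abs_exp_sub_one_le (x := 0.02) (by norm_num)
        rw [abs_le] at this
        norm_num at this
        linarith [this.2]
  have hupos : 0 ≤ (x / (4 * π)) ^ (-y / 2) := Real.rpow_nonneg (by positivity) _
  have hny : 0 ≤ (n : ℝ) ^ y := Real.rpow_nonneg (by positivity) _
  have h1 : ‖gamma t x y‖ * (630783 : ℝ) ^ ‖kappa t x y‖ * (n : ℝ) ^ y ≤
      (1.04 * (x / (4 * π)) ^ (-y / 2)) * 2 * (n : ℝ) ^ y := by
    refine mul_le_mul_of_nonneg_right (mul_le_mul (hg.trans ?_)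
      (row2_N_rpow_kappa_le ht ht' hx hy hy') (Real.rpow_nonneg (by norm_num) _)
      (by positivity)) hny
    exact mul_le_mul_of_nonneg_right he hupos
  have h2 : (1.04 * (x / (4 * π)) ^ (-y / 2)) * 2 * (n : ℝ) ^ y =
      2.08 * ((n : ℝ) ^ y * (x / (4 * π)) ^ (-y / 2)) := by ring
  have h3 := row2_n_rpow_mul_le hn' hx hx' hy
  nlinarith

/-- `b_n^t / n^{Re s_*} ≤ 3` on the box for `1 ≤ n ≤ 630783` (Thm. 1.3 (1.11): `Re s_* ≥ (1+y)/2 +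
(t/4) log(x/4π) − …`, and `log n ≤ ½ log(x/4π)`). [cite: Polymath2019, Prop. 8.1 (proof)] -/
lemma row2_ratio_le (ht : 0 < t) (ht' : t ≤ 0.186) (hx : (5 * 10 ^ 12 + 194858 : ℝ) ≤ x)
    (hx' : x ≤ 5 * 10 ^ 12 + 194858 + 1) (hy : 0 ≤ y) (hy' : y ≤ 1) {n : ℕ} (hn : 1 ≤ n)
    (hn' : n ≤ 630783) : bCoeff t n / (n : ℝ) ^ (sStar t x y).re ≤ 3 := by
  have hs := re_sStar_bound_holds t x y ⟨ht, by linarith, hy, hy', by linarith⟩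
  obtain ⟨hL0, hL2⟩ := row2_log_n_le hn hn' hx hx'
  obtain ⟨hl₁, hl₂⟩ := row2_log_u_bounds hx hx'
  set σ := (sStar t x y).re with hσ
  set L := Real.log n with hL
  set lu := Real.log (x / (4 * π)) with hlu
  have hn0 : (0 : ℝ) < n := by exact_mod_cast hn
  have hx1 : (1 : ℝ) ≤ x := by linarith
  -- the correction term is tiny
  have hmax : max (1 - 3 * y + 4 * y * (1 + y) / x ^ 2) 0 ≤ 9 := by
    refine max_le ?_ (by norm_num)
    have : 4 * y * (1 + y) / x ^ 2 ≤ 8 := by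
      rw [div_le_iff₀ (by positivity)]
      nlinarith
    linarith
  have hm : t / (2 * x ^ 2) * max (1 - 3 * y + 4 * y * (1 + y) / x ^ 2) 0 ≤ 1 / 14 := by
    have h1 : t / (2 * x ^ 2) ≤ 1 / 126 := by
      rw [div_le_div_iff₀ (by positivity) (by norm_num)]
      nlinarith
    have h2 : 0 ≤ t / (2 * x ^ 2) := by positivity
    calc t / (2 * x ^ 2) * max (1 - 3 * y + 4 * y * (1 + y) / x ^ 2) 0
        ≤ 1 / 126 * 9 := mul_le_mul h1 hmax (le_max_right _ _) (by norm_num)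
      _ = 1 / 14 := by norm_num
  have hσ' : t / 4 * lu - 1 / 14 ≤ σ := by
    have : 0 ≤ (1 + y) / 2 := by linarith
    linarith
  -- the exponent
  have hexp : t / 4 * L ^ 2 - L * σ ≤ 1 := by
    have h1 : L * σ ≥ L * (t / 4 * lu - 1 / 14) := mul_le_mul_of_nonneg_left hσ' hL0
    have h2 : t / 4 * L * (L - lu) ≤ 0 :=
      mul_nonpos_of_nonneg_of_nonpos (by positivity) (by linarith)
    have h3 : L ≤ 14 := by linarith
    nlinarith
  have hratio : bCoeff t n / (n : ℝ) ^ σ = Real.exp (t / 4 * L ^ 2 - L * σ) := by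
    rw [bCoeff, Real.rpow_def_of_pos hn0, ← Real.exp_sub]
  rw [hratio]
  calc Real.exp (t / 4 * L ^ 2 - L * σ) ≤ Real.exp 1 := Real.exp_le_exp.2 hexp
    _ ≤ 3 := by linarith [Real.exp_one_lt_d9]

/-- `e^{δ_n} − 1 ≤ 10⁻¹²` on the box, `δ_n = ((t²/16) log²(x/(4πn²)) + 0.626)/(x − 6.66)`,
`1 ≤ n ≤ 630783`. [cite: Polymath2019, Prop. 8.1 (proof)] -/
lemma row2_expDelta_le (ht : 0 ≤ t) (ht' : t ≤ 0.186) (hx : (5 * 10 ^ 12 + 194858 : ℝ) ≤ x)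
    (hx' : x ≤ 5 * 10 ^ 12 + 194858 + 1) {n : ℕ} (hn : 1 ≤ n) (hn' : n ≤ 630783) :
    0 ≤ Real.exp ((t ^ 2 / 16 * Real.log (x / (4 * π * (n : ℝ) ^ 2)) ^ 2 + 0.626) / (x - 6.66)) - 1
      ∧ Real.exp ((t ^ 2 / 16 * Real.log (x / (4 * π * (n : ℝ) ^ 2)) ^ 2 + 0.626) / (x - 6.66)) - 1
        ≤ 1e-12 := by
  obtain ⟨hL0, hL2⟩ := row2_log_n_le hn hn' hx hx'
  obtain ⟨hl₁, hl₂⟩ := row2_log_u_bounds hx hx'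
  obtain ⟨hu₁, _⟩ := row2_u_bounds hx hx'
  have hn0 : (0 : ℝ) < n := by exact_mod_cast hn
  have hlog : Real.log (x / (4 * π * (n : ℝ) ^ 2)) = Real.log (x / (4 * π)) - 2 * Real.log n := by
    rw [← div_div, Real.log_div (by positivity) (by positivity), Real.log_pow]
    norm_num
  set δ := (t ^ 2 / 16 * Real.log (x / (4 * π * (n : ℝ) ^ 2)) ^ 2 + 0.626) / (x - 6.66) with hδ
  have hδ0 : 0 ≤ δ := div_nonneg (by positivity) (by linarith)
  have hsq : Real.log (x / (4 * π * (n : ℝ) ^ 2)) ^ 2 ≤ 784 := by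
    rw [hlog]
    nlinarith
  have hδ1 : δ ≤ 5e-13 := by
    rw [hδ, div_le_iff₀ (by linarith)]
    nlinarith
  have hb := Real.abs_exp_sub_one_le (x := δ) (by rw [abs_of_nonneg hδ0]; linarith)
  rw [abs_of_nonneg hδ0, abs_le] at hb
  exact ⟨by linarith [Real.add_one_le_exp δ], by linarith [hb.2]⟩

/-- The bound `errAB ≤ 2·10⁻⁵` on the row-2 box (`t > 0`): every one of the `N = 630783` terms is
at most `4 · 3 · 10⁻¹²`. [cite: Polymath2019, Prop. 8.1 (proof)] -/
theorem errAB_row2 (ht : 0 < t) (ht' : t ≤ 0.186) (hx : (5 * 10 ^ 12 + 194858 : ℝ) ≤ x)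
    (hx' : x ≤ 5 * 10 ^ 12 + 194858 + 1) (hy : 0 ≤ y) (hy' : y ≤ 1) :
    errAB t x y ≤ 0.00002 := by
  have hN : rsN t x = 630783 := rsN_row2 ht.le ht' hx hx'
  unfold errAB
  rw [hN]
  have hterm : ∀ n ∈ Finset.Icc (1 : ℕ) 630783,
      (1 + ‖gamma t x y‖ * ((630783 : ℕ) : ℝ) ^ ‖kappa t x y‖ * (n : ℝ) ^ y) *
        (bCoeff t n / (n : ℝ) ^ (sStar t x y).re) *
          (Real.exp ((t ^ 2 / 16 * Real.log (x / (4 * π * (n : ℝ) ^ 2)) ^ 2 + 0.626) /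
            (x - 6.66)) - 1) ≤ 4 * 3 * 1e-12 := by
    intro n hn
    obtain ⟨hn1, hn2⟩ := Finset.mem_Icc.1 hn
    obtain ⟨hd0, hd1⟩ := row2_expDelta_le ht.le ht' hx hx' hn1 hn2
    have hw := row2_weight_le ht ht' hx hx' hy hy' hn2
    have hr := row2_ratio_le ht ht' hx hx' hy hy' hn1 hn2
    have hw0 : 0 ≤ 1 + ‖gamma t x y‖ * ((630783 : ℕ) : ℝ) ^ ‖kappa t x y‖ * (n : ℝ) ^ y := by
      positivity
    have hr0 : 0 ≤ bCoeff t n / (n : ℝ) ^ (sStar t x y).re := by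
      unfold bCoeff; positivity
    push_cast at hw ⊢
    exact mul_le_mul (mul_le_mul hw hr hr0 (by norm_num)) hd1 hd0 (by norm_num)
  refine (Finset.sum_le_sum hterm).trans ?_
  rw [Finset.sum_const, Nat.card_Icc]
  norm_num

/-- **`errAB + errC0 ≤ 1/500` on the row-2 box** (`0 < t ≤ 0.186`, `X ≤ x ≤ X + 1`,
`0 ≤ y ≤ 1`): the analogue for Table 1, row 2 of Prop. 8.1 (`e_A + e_B + e_{C,0} ≤ 1.25·10⁻³`
for row 1); here `errAB ≤ 2·10⁻⁵` and `errC0 ≤ 1.26·10⁻³`. [cite: Polymath2019, Prop. 8.1] -/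
theorem err_row2 (ht : 0 < t) (ht' : t ≤ 0.186) (hx : (5 * 10 ^ 12 + 194858 : ℝ) ≤ x)
    (hx' : x ≤ 5 * 10 ^ 12 + 194858 + 1) (hy : 0 ≤ y) (hy' : y ≤ 1) :
    errAB t x y + errC0 t x y ≤ 1 / 500 := by
  have h1 := errAB_row2 ht ht' hx hx' hy hy'
  have h2 := errC0_row2 ht.le ht' hx hx' hy hy'
  linarith

end errBounds

/-! ## Table 1, row 2 from a winding certificate -/

/-- **Polymath 15, Table 1, row 2 (barrier half) from a winding certificate for `f_t`.** Assume
Thm. 1.3 (`effective_approximation`). If for every `t ∈ [0, 0.186]` the finite sums `f_t(x+iy)`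
admit a winding certificate with margin `1/500` on the rectangle
`[5·10¹² + 194858, 5·10¹² + 194859] × [0.16733, 1]` (piece lists with `Re((-i)^d f_t) > 1/500`
and zero quarter-turn count, `WindingCertGt`), then `H_t(x+iy) ≠ 0` on the whole box, i.e.
`table1_row2_barrier_box` holds. The two numerical side conditions of
`box_zero_free_of_windingCert` are discharged here: `N = 630783` on the box (`rsN_row2`) and
`e_A + e_B + e_{C,0} ≤ errAB + errC0 ≤ 1/500 < margin` (`err_row2`). What remains for a full
certificate of the row is exactly the interval-arithmetic verification of the hypothesis `hcert`
(§8.4: "winding number of zero for each rectangle", Table 1 column "Winding Number" = `0`).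
[cite: Polymath2019, §10, Table 1 (row 2)] -/
theorem table1_row2_barrier_box_of_windingCert (h : effective_approximation)
    (hcert : ∀ t ∈ Icc (0 : ℝ) 0.186, WindingCertGt (fz t) (1 / 500)
      (5 * 10 ^ 12 + 194858) (5 * 10 ^ 12 + 194858 + 1) 0.16733 1) :
    table1_row2_barrier_box := by
  intro t x y ht ht' hx hx' hy hy'
  refine box_zero_free_of_windingCert h (t₀ := 0.186) (X := 5 * 10 ^ 12 + 194858)
    (y₀ := 0.16733) (μ := 1 / 500) (by norm_num) (by norm_num) (by norm_num) (by norm_num)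
    (by norm_num) (fun s hs x' hx' ↦ ?_) (fun s hs x' hx' y' hy' ↦ ?_) hcert t x y ht ht' hx hx' hy
    hy'
  · rw [rsN_row2 hs.1 hs.2 hx'.1 hx'.2, rsN_row2 le_rfl (by norm_num) hx'.1 hx'.2]
  · exact err_row2 hs.1 hs.2 hx'.1 hx'.2 (by linarith [hy'.1]) hy'.2

/-- The same packaged with the (ii)-half: Table 1, row 2 (`table1_row2`) from Thm. 1.3, the
hypothesis `FinalZeroFree 0.186 X 0.16733`, and a winding certificate for the barrier.
[cite: Polymath2019, §10, Table 1 (row 2)] -/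
theorem table1_row2_of_windingCert (h : effective_approximation)
    (hii : FinalZeroFree 0.186 (5 * 10 ^ 12 + 194858) 0.16733)
    (hcert : ∀ t ∈ Icc (0 : ℝ) 0.186, WindingCertGt (fz t) (1 / 500)
      (5 * 10 ^ 12 + 194858) (5 * 10 ^ 12 + 194858 + 1) 0.16733 1) :
    table1_row2 :=
  table1_row2_of_barrier_box hii (table1_row2_barrier_box_of_windingCert h hcert)

end Polymath15

end Literature.NumberTheory.LFunctions

end
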